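import Summits.Ventures.PercRepro.ProfilePointedCircuitClassesThruFiveGirth
import Summits.Ventures.PercRepro.ProfilePointedCircuitClassesSixFourteen

/-!
# PercRepro — THE q = 7 ROW IN THE GIRTH REGIME: THE CO-RANK-7 TOP THRESHOLD ON EVERY MATROID WITH AT MOST SIX MORE
POINTS THAN ITS RANK WHOSE `(ρ − 1)`-SUBSETS ARE INDEPENDENT (p5, gen 43; `proofs/P5-GM1.md` §65(m))

The nullity-6 chain of §63 (ProfilePointedCircuitClassesSixTop) carries the two conjecture defs `InOutBottomFive`
and `InOutPairBottomFive`, quantified over ALL matroids, and applies each exactly once — to the nullity-5 minor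
`N ／ x ∖ w` of the circuit class under study.  HERE the chain is restated with the two hypotheses quantified over
THE MINORS `N ／ x ∖ w` OF THE GIVEN MATROID ONLY (`InOutMinors`, `InOutPairMinors`: the same premises, the same
conclusions, for every `x, w`), with the same proofs (`gammaC_six_le_of_card_eq_two_of_minors`, …,
`thresholdIneq_seven_top_of_nullity_le_six_of_minors`).  In the girth regime both hypotheses hold: if every
`(ρ − 1)`-subset of `E` is independent then every `(ρ − 2)`-subset of the minor's ground set is independent in the
minor (`rk (N ／ x ∖ w) X = rk N (X + x) − 1`, `girth_minor`), and ProfilePointedCircuitClassesThruFiveGirth gives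
`in_5(e) ≤ out_6(e)` and `thru_5(S) ≤ thru_{n°−6}(S)` there.  HENCE: **Theorem A's step `(n − 6)·P_6 ≤ 7·P_7` on
every matroid with `#E = ρ + 6`, `ρ ≥ 8`, whose `(ρ − 1)`-subsets are independent** (`biIndep_step_six_of_girth`)
and **the co-rank-7 top threshold `(I_{ρ−1})` on every finite matroid with `#E ≤ ρ + 6`, `ρ ≥ 7`, whose
`(ρ − 1)`-subsets are independent** (`thresholdIneq_seven_top_of_girth`) — the first unconditional instance family
of the q = 7 row on unbounded ground sets (§63 had it modulo the two defs; §64 ADD 1 at `n = 14` modulo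
`InOutBottomTwelve`).
-/

open scoped Matroid

namespace PercRepro.Cogirth

open Finset ThmH Skew Shadow Profile

variable {α : Type} [DecidableEq α] {N : Matroid α} [N.Finite]

section SixGirth

/-- The per-point in–out inequality at the bottom of nullity `5` on the minors `N ／ x ∖ w` of `N` (the premises of
`InOutBottomFive`, for the minors of this one matroid). -/
def InOutMinors (N : Matroid α) [N.Finite] : Prop :=
  ∀ (x w e : α), x ∈ gr N → w ∈ gr N → x ≠ w → rk N {x} = 1 →
    e ∈ gr ((N ／ ({x} : Set α)) ＼ ({w} : Set α)) →
    (gr ((N ／ ({x} : Set α)) ＼ ({w} : Set α))).card =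
      rk ((N ／ ({x} : Set α)) ＼ ({w} : Set α)) (gr ((N ／ ({x} : Set α)) ＼ ({w} : Set α))) + 5 →
    7 ≤ rk ((N ／ ({x} : Set α)) ＼ ({w} : Set α)) (gr ((N ／ ({x} : Set α)) ＼ ({w} : Set α))) →
    inCount ((N ／ ({x} : Set α)) ＼ ({w} : Set α)) 5 e ≤ outCount ((N ／ ({x} : Set α)) ＼ ({w} : Set α)) 6 e

/-- The per-pair in–out inequality at the bottom of nullity `5` on the minors `N ／ x ∖ w` of `N`. -/
def InOutPairMinors (N : Matroid α) [N.Finite] : Prop :=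
  ∀ (x w : α) (S : Finset α), x ∈ gr N → w ∈ gr N → x ≠ w → rk N {x} = 1 →
    S ⊆ gr ((N ／ ({x} : Set α)) ＼ ({w} : Set α)) → S.card = 2 →
    (gr ((N ／ ({x} : Set α)) ＼ ({w} : Set α))).card =
      rk ((N ／ ({x} : Set α)) ＼ ({w} : Set α)) (gr ((N ／ ({x} : Set α)) ＼ ({w} : Set α))) + 5 →
    7 ≤ rk ((N ／ ({x} : Set α)) ＼ ({w} : Set α)) (gr ((N ／ ({x} : Set α)) ＼ ({w} : Set α))) →
    thruCount ((N ／ ({x} : Set α)) ＼ ({w} : Set α)) 5 S ≤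
      thruCount ((N ／ ({x} : Set α)) ＼ ({w} : Set α)) ((gr ((N ／ ({x} : Set α)) ＼ ({w} : Set α))).card - 6) S

/-- The universal hypotheses give the minors' ones. -/
theorem inOutMinors_of_inOutBottomFive (h : InOutBottomFive α) : InOutMinors N :=
  fun _ _ e _ _ _ _ he hn hR => h _ e he hn hR

/-- The universal hypotheses give the minors' ones. -/
theorem inOutPairMinors_of_inOutPairBottomFive (h : InOutPairBottomFive α) : InOutPairMinors N :=
  fun _ _ S _ _ _ _ hS hS2 hn hR => h _ S hS hS2 hn hR

/-- THE CLASS `#C = 2` AT NULLITY 6 MODULO THE MINORS' PER-POINT INEQUALITY (the proof of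
`gammaC_six_le_of_card_eq_two_of_inout` with the hypothesis applied to `N ／ x ∖ w₁`). -/
theorem gammaC_six_le_of_card_eq_two_of_minors (h₁ : InOutMinors N)
    (hn : (gr N).card = rk N (gr N) + 6) (hR : 8 ≤ rk N (gr N))
    (x : α) {C : Finset α} (hC : C.card = 2) : gammaC N 6 x C ≤ gammaC N ((gr N).card - 7) x C := by
  obtain ⟨w₁, w₂, hw12, rfl⟩ := card_eq_two.1 hC
  rcases ((biIndepSets N 6).filter (fun W => x ∉ W ∧ x ∈ clF N W ∧ fundC N W x = {w₁, w₂})).eq_empty_or_nonempty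
    with hemp | ⟨W₀, hW₀⟩
  · unfold gammaC
    rw [hemp, card_empty]
    exact Nat.zero_le _
  obtain ⟨-, hCg, hxg, hxC, hrk, hxcl, hfund, hx1⟩ := circuit_facts_of_mem_class hW₀
  have hw₂g : w₂ ∈ gr N := hCg (mem_insert_of_mem (mem_singleton_self _))
  have hxw₂ : x ≠ w₂ := fun h => hxC (h ▸ mem_insert_of_mem (mem_singleton_self _))
  have hrk2 : rk N {w₁, w₂} = 2 := by rw [hrk, card_pair hw12]
  have hxn2 : x ∉ clF N {w₂} := by
    have h := hfund w₁ (mem_insert_self _ _)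
    have e : ({w₁, w₂} : Finset α).erase w₁ = {w₂} := by
      rw [erase_insert]
      rw [mem_singleton]; exact hw12
    rwa [e] at h
  have hxn1 : x ∉ clF N {w₁} := by
    have h := hfund w₂ (mem_insert_of_mem (mem_singleton_self _))
    have e : ({w₁, w₂} : Finset α).erase w₂ = {w₁} := by
      rw [erase_insert_of_ne hw12, erase_singleton, insert_empty]
    rwa [e] at h
  obtain ⟨hgr₀, hcard₀, hrkg₀⟩ :=
    minor_facts_of_circuit hCg hxg hxC hrk hxcl hfund hx1 (mem_insert_self w₁ {w₂})
  have e : (gr N).card - 7 = (gr N).card - 1 - 6 := by omega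
  rw [e]
  apply gammaC_le_of_card_eq_two_of_inout' hw12 hCg hxg hxC hrk2 hxcl hxn2 hxn1 (by norm_num) (by omega)
  have hw₂g₀ : w₂ ∈ gr ((N ／ ({x} : Set α)) ＼ ({w₁} : Set α)) := by
    rw [hgr₀]
    exact mem_erase.2 ⟨hw12.symm, mem_erase.2 ⟨fun h => hxw₂ h.symm, hw₂g⟩⟩
  have hn₀ : (gr ((N ／ ({x} : Set α)) ＼ ({w₁} : Set α))).card =
      rk ((N ／ ({x} : Set α)) ＼ ({w₁} : Set α)) (gr ((N ／ ({x} : Set α)) ＼ ({w₁} : Set α))) + 5 := by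
    rw [hcard₀, hrkg₀]
    omega
  have hR₀ : 7 ≤ rk ((N ／ ({x} : Set α)) ＼ ({w₁} : Set α)) (gr ((N ／ ({x} : Set α)) ＼ ({w₁} : Set α))) := by
    rw [hrkg₀]
    omega
  have e1 : (6 : ℕ) - 1 = 5 := by norm_num
  rw [e1]
  have hw₁g : w₁ ∈ gr N := hCg (mem_insert_self _ _)
  have hxw₁ : x ≠ w₁ := fun h => hxC (h ▸ mem_insert_self _ _)
  exact h₁ x w₁ w₂ hxg hw₁g hxw₁ hx1 hw₂g₀ hn₀ hR₀

/-- THE CLASS `#C = 3` AT NULLITY 6 MODULO THE MINORS' PER-PAIR INEQUALITY. -/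
theorem gammaC_six_le_of_card_eq_three_of_minors (h₂ : InOutPairMinors N)
    (hn : (gr N).card = rk N (gr N) + 6) (hR : 8 ≤ rk N (gr N))
    (x : α) {C : Finset α} (hC : C.card = 3) : gammaC N 6 x C ≤ gammaC N ((gr N).card - 7) x C := by
  rcases ((biIndepSets N 6).filter (fun W => x ∉ W ∧ x ∈ clF N W ∧ fundC N W x = C)).eq_empty_or_nonempty
    with hemp | ⟨W₀, hW₀⟩
  · unfold gammaC
    rw [hemp, card_empty]
    exact Nat.zero_le _
  obtain ⟨-, hCg, hxg, hxC, hrk, hxcl, hfund, hx1⟩ := circuit_facts_of_mem_class hW₀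
  obtain ⟨w, hw⟩ : C.Nonempty := card_pos.1 (by omega)
  obtain ⟨hgr₀, hcard₀, hrkg₀⟩ := minor_facts_of_circuit hCg hxg hxC hrk hxcl hfund hx1 hw
  have e : (gr N).card - 7 = (gr N).card - 1 - 6 := by omega
  rw [e, gammaC_le_iff_thruCount_le hCg hxg hxC hrk hxcl hfund hw (by norm_num) (by omega)]
  have hSg : C.erase w ⊆ gr ((N ／ ({x} : Set α)) ＼ ({w} : Set α)) := by
    rw [hgr₀]
    intro a ha
    rw [mem_erase] at ha
    exact mem_erase.2 ⟨ha.1, mem_erase.2 ⟨fun h => hxC (h ▸ ha.2), hCg ha.2⟩⟩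
  have hScard : (C.erase w).card = 2 := by rw [card_erase_of_mem hw, hC]
  have hn₀ : (gr ((N ／ ({x} : Set α)) ＼ ({w} : Set α))).card =
      rk ((N ／ ({x} : Set α)) ＼ ({w} : Set α)) (gr ((N ／ ({x} : Set α)) ＼ ({w} : Set α))) + 5 := by
    rw [hcard₀, hrkg₀]
    omega
  have hR₀ : 7 ≤ rk ((N ／ ({x} : Set α)) ＼ ({w} : Set α)) (gr ((N ／ ({x} : Set α)) ＼ ({w} : Set α))) := by
    rw [hrkg₀]
    omega
  have hwg : w ∈ gr N := hCg hw
  have hxw : x ≠ w := fun h => hxC (h ▸ hw)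
  have h := h₂ x w (C.erase w) hxg hwg hxw hx1 hSg hScard hn₀ hR₀
  rw [hcard₀] at h
  have e1 : (6 : ℕ) - 1 = 5 := by norm_num
  rw [e1]
  exact h

/-- The bottom-level per-circuit claim at nullity `6` modulo the minors' two inequalities. -/
theorem gammaC_six_le_of_nullity_six_of_minors (h₁ : InOutMinors N) (h₂ : InOutPairMinors N)
    (hn : (gr N).card = rk N (gr N) + 6) (hR : 8 ≤ rk N (gr N))
    (x : α) (C : Finset α) : gammaC N 6 x C ≤ gammaC N ((gr N).card - 7) x C := by
  rcases Nat.lt_or_ge 6 C.card with h7 | h6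
  · rw [gammaC_eq_zero_of_lt_card h7]
    exact Nat.zero_le _
  · by_cases hx : x ∈ gr N
    · interval_cases hc : C.card
      · rw [gammaC_eq_zero_of_card_eq_zero hc (by norm_num) hx]
        exact Nat.zero_le _
      · exact gammaC_six_le_of_card_eq_one hn hR x hc
      · exact gammaC_six_le_of_card_eq_two_of_minors h₁ hn hR x hc
      · exact gammaC_six_le_of_card_eq_three_of_minors h₂ hn hR x hc
      · have h := gammaC_le_of_card_eq_nullity_sub_two (ν := 6) (by norm_num) hn (by omega) x (by rw [hc])
        simpa using h
      · have h := gammaC_le_of_card_eq_nullity_sub_one (ν := 6) hn (by omega) x (by norm_num) (by rw [hc])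
        simpa using h
      · have h := gammaC_le_of_card_eq_nullity (ν := 6) hn (by omega) x (by rw [hc])
        simpa using h
    · have h0 : gammaC N 6 x C = 0 := by
        unfold gammaC
        rw [card_eq_zero, filter_eq_empty_iff]
        intro W _ hWC
        exact hx (clF_subset_gr W hWC.2.1)
      rw [h0]
      exact Nat.zero_le _

/-- `κ_6(x) ≤ κ_{n−7}(x)` modulo the minors' two inequalities. -/
theorem capCount_six_le_of_nullity_six_of_minors (h₁ : InOutMinors N) (h₂ : InOutPairMinors N)
    (hn : (gr N).card = rk N (gr N) + 6) (hR : 8 ≤ rk N (gr N))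
    (x : α) : capCount N 6 x ≤ capCount N ((gr N).card - 7) x := by
  rw [capCount_eq_sum_gammaC, capCount_eq_sum_gammaC]
  exact sum_le_sum (fun C _ => gammaC_six_le_of_nullity_six_of_minors h₁ h₂ hn hR x C)

/-- `out_6(x) ≤ in_7(x)` modulo the minors' two inequalities. -/
theorem outCount_six_le_inCount_seven_of_nullity_six_of_minors (h₁ : InOutMinors N)
    (h₂ : InOutPairMinors N) (hn : (gr N).card = rk N (gr N) + 6) (hR : 8 ≤ rk N (gr N)) {x : α}
    (hx : x ∈ gr N) : outCount N 6 x ≤ inCount N 7 x := by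
  have h := outCount_add_capCount_mirror (M := N) 6 hx (by omega)
  have h2 := capCount_six_le_of_nullity_six_of_minors h₁ h₂ hn hR x
  norm_num at h
  omega

/-- **THEOREM A'S STEP AT THE LEVEL `6` MODULO THE MINORS' TWO INEQUALITIES**: `(n − 6)·P_6 ≤ 7·P_7`. -/
theorem biIndep_step_six_of_nullity_six_of_minors (h₁ : InOutMinors N) (h₂ : InOutPairMinors N)
    (hn : (gr N).card = rk N (gr N) + 6) (hR : 8 ≤ rk N (gr N)) :
    ((gr N).card - 6) * (biIndepSets N 6).card ≤ 7 * (biIndepSets N 7).card := by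
  rw [← sum_outCount, ← sum_inCount]
  exact sum_le_sum (fun x hx => outCount_six_le_inCount_seven_of_nullity_six_of_minors h₁ h₂ hn hR hx)

/-- `(I_{ρ−1})` at co-rank `7` on `#E = ρ(E) + 6` modulo the minors' two inequalities. -/
theorem thresholdIneq_seven_top_of_card_eq_of_minors (h₁ : InOutMinors N) (h₂ : InOutPairMinors N)
    (hn : (gr N).card = rk N (gr N) + 6) (hR : 8 ≤ rk N (gr N)) :
    ThresholdIneq N 7 (rk N (gr N) - 1) := by
  have hn' : (gr N).card = (rk N (gr N) - 1) + 7 := by omega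
  unfold ThresholdIneq
  rw [thresholdSum_of_card_eq hn' (by norm_num), levelSetCoQ_eq_biIndepSets_of_card_eq hn']
  have h := biIndep_step_six_of_nullity_six_of_minors h₁ h₂ hn hR
  have e1 : (gr N).card - 6 = (rk N (gr N) - 1) + 1 := by omega
  rw [e1] at h
  exact h

/-- **THE CO-RANK-7 TOP THRESHOLD ON `#E ≤ ρ + 6`, `ρ ≥ 7`, MODULO THE MINORS' TWO INEQUALITIES.** -/
theorem thresholdIneq_seven_top_of_nullity_le_six_of_minors (h₁ : InOutMinors N) (h₂ : InOutPairMinors N)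
    (hn : (gr N).card ≤ rk N (gr N) + 6) (hR : 7 ≤ rk N (gr N)) :
    ThresholdIneq N 7 (rk N (gr N) - 1) := by
  by_cases hlow : (gr N).card + 2 ≤ rk N (gr N) + 7
  · exact thresholdIneq_top_of_card_add_two_le (by norm_num) hlow
  · by_cases hRq : rk N (gr N) = 7
    · exact thresholdIneq_top_of_rk_eq (by norm_num) hRq
    · exact thresholdIneq_seven_top_of_card_eq_of_minors h₁ h₂ (by omega) (by omega)

/-- **THE GIRTH PASSES TO THE MINORS**: if every `(ρ − 1)`-subset of `E` is independent and the minor `N ／ x ∖ w`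
(`x ≠ w` in `E`, `x` a non-loop) has `#E° = ρ° + 5`, then every `(ρ° − 1)`-subset of `E°` is independent in the
minor: `rk (N ／ x ∖ w) X = rk N (X + x) − 1 = #X`. -/
theorem girth_minor (hn : (gr N).card = rk N (gr N) + 6)
    (hg : ∀ X ⊆ gr N, X.card = rk N (gr N) - 1 → rk N X = X.card) {x w : α} (hxg : x ∈ gr N)
    (hwg : w ∈ gr N) (hxw : x ≠ w) (hx1 : rk N {x} = 1)
    (hn₀ : (gr ((N ／ ({x} : Set α)) ＼ ({w} : Set α))).card =
      rk ((N ／ ({x} : Set α)) ＼ ({w} : Set α)) (gr ((N ／ ({x} : Set α)) ＼ ({w} : Set α))) + 5)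
    (hR₀ : 7 ≤ rk ((N ／ ({x} : Set α)) ＼ ({w} : Set α)) (gr ((N ／ ({x} : Set α)) ＼ ({w} : Set α)))) :
    ∀ X ⊆ gr ((N ／ ({x} : Set α)) ＼ ({w} : Set α)),
      X.card = rk ((N ／ ({x} : Set α)) ＼ ({w} : Set α)) (gr ((N ／ ({x} : Set α)) ＼ ({w} : Set α))) - 1 →
      rk ((N ／ ({x} : Set α)) ＼ ({w} : Set α)) X = X.card := by
  intro X hX hXc
  have hgr : gr ((N ／ ({x} : Set α)) ＼ ({w} : Set α)) = ((gr N).erase x).erase w := by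
    rw [gr_delete', gr_contract']
  have hcard : (gr ((N ／ ({x} : Set α)) ＼ ({w} : Set α))).card = (gr N).card - 2 := by
    rw [hgr, card_erase_of_mem (mem_erase.2 ⟨hxw.symm, hwg⟩), card_erase_of_mem hxg]
    omega
  -- the minor has rank `ρ − 1`, so `#X = ρ − 2`
  have hX2 : X.card = rk N (gr N) - 2 := by omega
  have hXsub : X ⊆ (gr N).erase x := by
    rw [hgr] at hX
    exact hX.trans (erase_subset _ _)
  have hxX : x ∉ X := fun h => (mem_erase.1 (hXsub h)).1 rfl
  -- `rk (N ／ x ∖ w) X = rk (N ／ x) X = rk N (X + x) − 1`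
  have h1 : rk ((N ／ ({x} : Set α)) ＼ ({w} : Set α)) X = rk (N ／ ({x} : Set α)) X := by
    apply rk_delete (M := N ／ ({x} : Set α))
    rw [gr_contract']
    rw [hgr] at hX
    exact hX
  have hind : N.Indep ({x} : Set α) := by
    have h := indep_of_rk_eq_card' (M := N) (X := {x}) (by rw [hx1, card_singleton])
    simpa using h
  have h2 := rk_contract_add_one (M := N) hind hXsub
  -- `X + x` is a `(ρ − 1)`-subset of `E`, independent by the girth
  have h3 : rk N (insert x X) = (insert x X).card := by
    apply hg
    · exact insert_subset hxg (hXsub.trans (erase_subset _ _))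
    · rw [card_insert_of_notMem hxX, hX2]; omega
  rw [card_insert_of_notMem hxX] at h3
  have h4 : rk ((N ／ ({x} : Set α)) ＼ ({w} : Set α)) X + 1 = X.card + 1 := by rw [h1, h2, h3]
  omega

/-- The minors' per-point inequality holds in the girth regime. -/
theorem inOutMinors_of_girth (hn : (gr N).card = rk N (gr N) + 6)
    (hg : ∀ X ⊆ gr N, X.card = rk N (gr N) - 1 → rk N X = X.card) : InOutMinors N := by
  intro x w e hxg hwg hxw hx1 _ hn₀ hR₀
  exact inCount_five_le_outCount_six_of_girth hn₀ hR₀ (girth_minor hn hg hxg hwg hxw hx1 hn₀ hR₀) e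

/-- The minors' per-pair inequality holds in the girth regime. -/
theorem inOutPairMinors_of_girth (hn : (gr N).card = rk N (gr N) + 6)
    (hg : ∀ X ⊆ gr N, X.card = rk N (gr N) - 1 → rk N X = X.card) : InOutPairMinors N := by
  intro x w S hxg hwg hxw hx1 hS hS2 hn₀ hR₀
  exact thruCount_five_le_thruCount_of_girth hn₀ hR₀ (girth_minor hn hg hxg hwg hxw hx1 hn₀ hR₀) hS (by omega)

/-- **THEOREM A'S STEP AT THE LEVEL `6` IN THE GIRTH REGIME**: `(n − 6)·P_6 ≤ 7·P_7` on every matroid with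
`#E = ρ + 6`, `ρ ≥ 8`, whose `(ρ − 1)`-subsets are independent. -/
theorem biIndep_step_six_of_girth (hn : (gr N).card = rk N (gr N) + 6) (hR : 8 ≤ rk N (gr N))
    (hg : ∀ X ⊆ gr N, X.card = rk N (gr N) - 1 → rk N X = X.card) :
    ((gr N).card - 6) * (biIndepSets N 6).card ≤ 7 * (biIndepSets N 7).card :=
  biIndep_step_six_of_nullity_six_of_minors (inOutMinors_of_girth hn hg) (inOutPairMinors_of_girth hn hg) hn hR

/-- **THE q = 7 ROW IN THE GIRTH REGIME**: the co-rank-7 top threshold `(I_{ρ−1})` on every finite matroid with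
`#E ≤ ρ + 6`, `ρ ≥ 7`, whose `(ρ − 1)`-subsets are all independent. -/
theorem thresholdIneq_seven_top_of_girth (hn : (gr N).card ≤ rk N (gr N) + 6) (hR : 7 ≤ rk N (gr N))
    (hg : ∀ X ⊆ gr N, X.card = rk N (gr N) - 1 → rk N X = X.card) :
    ThresholdIneq N 7 (rk N (gr N) - 1) := by
  by_cases hlow : (gr N).card + 2 ≤ rk N (gr N) + 7
  · exact thresholdIneq_top_of_card_add_two_le (by norm_num) hlow
  · by_cases hRq : rk N (gr N) = 7
    · exact thresholdIneq_top_of_rk_eq (by norm_num) hRq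
    · have hn6 : (gr N).card = rk N (gr N) + 6 := by omega
      exact thresholdIneq_seven_top_of_card_eq_of_minors (inOutMinors_of_girth hn6 hg)
        (inOutPairMinors_of_girth hn6 hg) hn6 (by omega)

end SixGirth

end PercRepro.Cogirth
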